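import Literature.AlgebraicGeometry.ComplexMultiplication.CyclotomicFermatCMTypesTwoPowerLevelComplete
import Literature.AlgebraicGeometry.ComplexMultiplication.CyclotomicFermatCMTypesPrimePowerIsogenies
import Literature.AlgebraicGeometry.ComplexMultiplication.CyclotomicFermatCMTypesTwoPowerLevelCoincidences
import HarnessLib

/-!
# Koblitz–Rohrlich THEOREM 4 (`N = 2ⁿ`) AS AN EQUIVALENCE and ON ABELIAN VARIETIES, for every `n ≥ 4`:
# the isogeny classes of the abelian varieties of Fermat type `Φ_{H_{r,s,t}}` of `ℚ(ζ_{2ⁿ})`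

Layer `Literature/AlgebraicGeometry/ComplexMultiplication`, namespace `…ComplexMultiplication.CyclotomicFermatCMType`; sequel of
`CyclotomicFermatCMTypesTwoPowerLevelComplete` (the necessary direction: `H_{τ′} = H_τ` with a unit among the six entries forces a
permutation or, after a common unit factor, one of SEVEN explicit pairs — `perm_or_exceptional_of_fermatCMType_eq_twoPow`) and of
`CyclotomicFermatCMTypesPrimePowerIsogenies` (Shimura–Taniyama at any level, `A_τ ∼ A_{τ′} ⟺ H_{τ′} = H_{uτ}` for a unit `u`; THEOREM 3 on
abelian varieties at `N = 3ⁿ`).  THEOREMS ONLY (no definition, no named fact, no `sorry`, no kernel `decide` beyond `ZMod 2`∕`ZMod 4` numerals).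

THE SOURCE.  N. Koblitz, D. Rohrlich, *Simple factors in the Jacobian of a Fermat curve*, Canad. J. Math. **30** (1978) 1183–1205.
THEOREM 4 (p. 1186): "Suppose `N = 2ⁿ`. Then the only isogenies apart from the obvious ones are between pairs of lattices corresponding to
the triples a) `(2ᵐ, 2ⁿ⁻¹ − 2ᵐ⁺¹, 2ⁿ⁻¹ + 2ᵐ)` and `(2ᵐ⁺¹, 2ⁿ⁻² − 2ᵐ, 3(2ⁿ⁻²) − 2ᵐ)` … e) `(2ᵐ, 2ⁿ⁻¹, 2ⁿ⁻¹ − 2ᵐ)` and `(2ᵐ, 2ᵐ, 2ⁿ − 2ᵐ⁺¹)`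
…"; §5 (p. 1200): "Theorem 4 can be restated as follows.  PROPOSITION. Let `N = 2ⁿ`, `n ≥ 4`. Let `N₁ = 2ⁿ⁻¹`, `N₂ = 2ⁿ⁻²`, `τ = (r, s, t)`,
`τ′ = (r′, s′, t′)`, `H_τ = H_{τ′}`. Suppose that `τ′` is not a permutation of `τ`, and that g.c.d.`(r, s, t, r′, s′, t′) = 1`. Then for some
`u ∈ (ℤ/Nℤ)*`, `uτ` and `uτ′` are permutations of one of the following pairs of triples: (1) `(N − 4, 1, 3)`, `(N₁ − 2, N₁ − 1, 3)`; (2) any 2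
of the triples `(N − 2, 1, 1)`, `(N₁, 1, N₁ − 1)`, `(2, N₁ − 1, N₁ − 1)`; (3) any 2 of the triples `(N − 4, 2, 2)`, `(N₁, 2, N₁ − 2)`,
`(N₁ − 2, 1, N₁ + 1)`, `(2, N₂ − 1, 3N₂ − 1)`."; §1 (p. 1184): "two such `L_{r,s}` are isogenous if and only if their CM-types are the same up
to an element of Gal(`ℚ(ζ)/ℚ`) … `hH_{r,s} = H_{r′,s′}` for some `h`".

## What is proved

* §1 (every `n ≥ 3`, `N₁ = 2ⁿ⁻¹`, `N₂ = 2ⁿ⁻²` as residues): the two coincidences of lists (2), (3) that the siblings did not have as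
  equalities of `H` — **`H_{(2, N₁−1, N₁−1)} = H_{(N−2, 1, 1)}`** (`fermatCMType_twoPow_e_stabiliser`; `(2, N₁−1, N₁−1) = (N₁−1)·(N−2, 1, 1)`,
  so this says `N₁ − 1 ∈ W_{(N−2,1,1)}`) and **`H_{(2, N₂−1, 3N₂−1)} = H_{(N₁−2, 1, N₁+1)}`** (`fermatCMType_twoPow_a_stabiliser`;
  `(2, N₂−1, 3N₂−1) = (N₂−1)·(N₁−2, 1, N₁+1)`), both read off the parity criterion at `p = 2` (tree `fermatCMType_eq_of_forall_countP`).
* §2: the SEVEN pairs of `perm_or_exceptional_of_fermatCMType_eq_twoPow` have equal `H` for every `n ≥ 3`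
  (`fermatCMType_eq_of_exceptional_pairs_twoPow`: (1) `H_{(N₁−2,N₁−1,3)} = H_{(N−4,1,3)}`; (2) `H_{(N₁,1,N₁−1)} = H_{(N−2,1,1)} = H_{(2,N₁−1,N₁−1)}`;
  (3) `H_{(N−4,2,2)} = H_{(2,N₂−1,3N₂−1)} = H_{(N₁,2,N₁−2)} = H_{(N₁−2,1,N₁+1)}` — the siblings' Theorem 4 d)₀, e)₀, "Furthermore"₀, c)₀ and §1);
  **THEOREM 4 ∕ the §5 PROPOSITION AS AN EQUIVALENCE** for `n ≥ 4`: for triples of non-zero residues with `r + s + t = 0 = r′ + s′ + t′` and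
  a unit among the six entries, `H_{τ′} = H_τ` iff `{τ′} = {τ}` or, for a unit `w`, `(wτ, wτ′)` is one of the seven pairs up to order
  (`fermatCMType_eq_iff_perm_or_exceptional_twoPow`); and **the Proposition AS PRINTED** (ten unordered pairs: `uτ`, `uτ′` are
  permutations of two different triples of one of the lists (1), (2), (3); `exists_unit_printed_pair_of_fermatCMType_eq_twoPow`).
* §3 **THEOREM 4 ON ABELIAN VARIETIES** (`n ≥ 4`): the translate form (`forall_mem_fermatCMType_iff_iff_perm_or_exceptional_twoPow`);
  abelian varieties `A`, `A′` of types `Φ_{H_τ}`, `Φ_{H_{τ′}}` of `ℚ(ζ_{2ⁿ})` (`τ`, `τ′` as above) are ISOGENOUS iff `{τ′} = {uτ}` for a unit `u`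
  ("obvious") or, for units `w, w′`, `(wτ, w′τ′)` is one of the seven pairs up to order (`isIsogenous_fermatCMType_iff_twoPow`,
  `isIsogenous_iff_obvious_or_exceptional_twoPow`); NON-VACUITY: abelian varieties of the types `Φ_{H_{(N−4,1,3)}}`, `Φ_{H_{(N₁−2,N₁−1,3)}}`
  exist (dimension `φ(2ⁿ)/2 = 2ⁿ⁻²`), are isogenous, and `(N₁−2, N₁−1, 3)` is no unit multiple of a permutation of `(N−4, 1, 3)`
  (`exists_isIsogenous_not_obvious_twoPow`, from the sibling `not_exists_multiset_eq_twoPow_d`).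

## Honest column / NOT here

* As in every sibling, "isogeny of lattices `L_{r,s,t}`" is typed as isogeny of abelian varieties REALISING the CM types `Φ_{H_τ}` of
  `ℚ(ζ_{2ⁿ})` read at the full level (Shimura–Taniyama through `isIsogenous_fermatCMType_iff_exists_eq_mul`); hence the hypothesis "a unit
  among the six entries" (g.c.d. `= 1`, one triple primitive).  Theorem 4's pairs with `m ≥ 1` and the all-even pair `((N−4,2,2), (N₁,2,N₁−2))`
  of list (3) concern types induced from level `2ⁿ⁻¹` and are outside these statements (the siblings `…TwoPowerLevelCoincidences`,
  `…Furthermore`, `…Families` have them as equalities of `H` by level pullback).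
* SEVEN versus TEN pairs: of K–R's ten printed unordered pairs, `perm_or_exceptional_of_fermatCMType_eq_twoPow` needs seven; the other three
  are `((N₁,1,N₁−1), (2,N₁−1,N₁−1))`, `((N₁,2,N₁−2), (2,N₂−1,3N₂−1))` (the pairs `((N₁,1,N₁−1), (N−2,1,1))`, `((N₁,2,N₁−2), (N₁−2,1,N₁+1))`
  multiplied through by the units `N₁ − 1`, `N₂ − 1`, §1) and the all-even pair; the printed form is derived as a weakening (§2).
* The proofs are the parity criterion at `p = 2` (siblings `…PrimePowerParityCriterion`, `…TwoPowerLevelComplete` — ours), not K–R's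
  omitted Theorem-2-style argument nor their Probabilistic Lemma (`n ≥ 9`) with the computer check of `N = 16, …, 256`.
* `n ≥ 4` as printed (`n ≥ 3` suffices in §1 and for the seven equalities); the complete lists at `N = 8` and, normalised, `N = 16` are the
  siblings `…TwoPowerLevelIsogenies`, `…TwoPowerLevelSixteen` (kernel enumeration).  The lettered families a)–e) of Theorem 4 (b) is
  illegible in our copy, cf. the sibling `…Families`) are not used: the §5 Proposition is K–R's own normal form of Theorem 4.

## References

* [KoblitzRohrlich1978] N. Koblitz, D. Rohrlich, Canad. J. Math. 30 (1978) 1183–1205: §1 (p. 1184), Theorem 4 (p. 1186), §5 Proposition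
  (p. 1200).
* [Shimura1998] G. Shimura, *Abelian Varieties with Complex Multiplication and Modular Functions*, §6.1 Corollary, §6.2 Thm. 3, §8.4
  Example (1) (through `CyclotomicCMTypeIsogenyClasses`, `CyclotomicFermatCMTypesPrimePowerIsogenies` and `exists_isCMTypeRealisation`).

## Provenance

Cell `pub-hodgecm2` (COR-CM), literature seat `lit-deligne-3` gen 38 (claim KR78-THM4-IFF; count-neutral, own lane).
-/

noncomputable section

open NumberField

namespace Literature.AlgebraicGeometry.ComplexMultiplication

open Literature.NumberTheory.ComplexMultiplication
open Literature.AlgebraicGeometry.Motives (CMType)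
open Literature.AlgebraicGeometry.HodgeTheory (fermatCMType)
open Literature.AlgebraicGeometry.Pohlmann1968 Literature.AlgebraicGeometry.Pohlmann1968.Cyclotomic

namespace CyclotomicFermatCMType

/-! ## §1 The two stabiliser coincidences for every `n`: `N₁ − 1 ∈ W_{(N−2,1,1)}` and `N₂ − 1 ∈ W_{(N₁−2,1,N₁+1)}` -/

section Stabilisers

variable {n : ℕ}

/-- The reduction of `2ʲ` modulo `2` vanishes for `j ≥ 1` (private copy). [folklore] -/
private theorem castHom_two_two_pow' (hn : n ≠ 0) {j : ℕ} (hj : 1 ≤ j) :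
    ZMod.castHom (dvd_pow_self 2 hn) (ZMod 2) ((2 : ZMod (2 ^ n)) ^ j) = 0 := by
  rw [map_pow, map_ofNat, show (2 : ZMod 2) = 0 from by decide, zero_pow (by omega)]

/-- Disjoint alternatives add: `[P ∨ Q] = [P] + [Q]` when `P`, `Q` exclude each other (private copy). [folklore] -/
private theorem ite_or_eq_add' {P Q : Prop} [Decidable P] [Decidable Q] (h : ¬(P ∧ Q)) :
    (if P ∨ Q then (1 : ℕ) else 0) = (if P then 1 else 0) + (if Q then 1 else 0) := by
  by_cases hP : P <;> by_cases hQ : Q <;> simp_all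

/-- **`H_{(2, N₁−1, N₁−1)} = H_{(N−2, 1, 1)}` for every `n ≥ 3`** — the pair "`(N − 2, 1, 1)`, `(2, N₁ − 1, N₁ − 1)`" of list (2);
equivalently `N₁ − 1` stabilises `H_{(1,1,N−2)}` (`(N₁−1)·(N−2, 1, 1) = (2, N₁−1, N₁−1)`).  By the parity criterion: both multiplicity
functions have odd part supported on `{±1, ±1 + N₁}` with the same signs. [cite: KoblitzRohrlich1978, §5 Proposition, list (2) (p. 1200)] -/
theorem fermatCMType_twoPow_e_stabiliser (hn : 3 ≤ n) :
    fermatCMType (2 ^ n) 2 ((2 : ZMod (2 ^ n)) ^ (n - 1) - 1) ((2 : ZMod (2 ^ n)) ^ (n - 1) - 1) = fermatCMType (2 ^ n) (-2) 1 1 := by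
  classical
  have hn0 : n ≠ 0 := by omega
  have hn2 : 2 ≤ n := by omega
  haveI : Fact (1 < 2 ^ n) := ⟨Nat.one_lt_pow hn0 (by norm_num)⟩
  set N₁ : ZMod (2 ^ n) := (2 : ZMod (2 ^ n)) ^ (n - 1) with hN₁
  have e2N₁ : 2 * N₁ = 0 := two_mul_pow_pred hn0
  have hN₁0 : N₁ ≠ 0 := two_pow_ne_zero_of_lt (by omega)
  have h2N₁ : ZMod.castHom (dvd_pow_self 2 hn0) (ZMod 2) N₁ = 0 := castHom_two_two_pow' hn0 (by omega)
  have hu : IsUnit (N₁ - 1) := (isUnit_iff_castHom_two_eq_one hn0 _).2 (by rw [map_sub, map_one, h2N₁, zero_sub]; decide)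
  have h20 : (2 : ZMod (2 ^ n)) ≠ 0 := by
    have h := two_pow_ne_zero_of_lt (n := n) (j := 1) (by omega)
    rwa [pow_one] at h
  refine fermatCMType_eq_of_forall_countP (p := 2) hn0 (neg_ne_zero.2 h20) one_ne_zero one_ne_zero (by ring) h20 hu.ne_zero
    hu.ne_zero (by linear_combination e2N₁) fun x _ => ?_
  -- normal forms `x = 1`, `x = 1 + N₁`, `x = −1`, `x = N₁ − 1` of the eight conditions
  have n1 : (-x = 1) ↔ (x = -1) := neg_eq_iff_eq_neg
  have n2 : (-x = N₁ - 1) ↔ (x = 1 + N₁) := by constructor <;> intro h <;> linear_combination -h - e2N₁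
  have n3 : (-x = -1) ↔ (x = 1) := neg_inj
  have n4 : (-x = -1 + N₁) ↔ (x = 1 + N₁) := by constructor <;> intro h <;> linear_combination -h - e2N₁
  have n5 : (-x = 1 + N₁) ↔ (x = N₁ - 1) := by constructor <;> intro h <;> linear_combination -h - e2N₁
  have n6 : (x = -1 + N₁) ↔ (x = N₁ - 1) := by rw [neg_add_eq_sub]
  have d1 : ¬(x = 1 ∧ x = 1 + N₁) := fun ⟨h1, h2⟩ => hN₁0 (by linear_combination h1 - h2)
  have d2 : ¬(x = -1 ∧ x = N₁ - 1) := fun ⟨h1, h2⟩ => hN₁0 (by linear_combination h1 - h2)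
  simp only [Multiset.insert_eq_cons, ← Multiset.cons_zero, Multiset.countP_cons, Multiset.countP_zero, Nat.cast_ofNat,
    fibre_iff_of_isUnit hn0 isUnit_one, fibre_iff_of_isUnit hn0 hu,
    fibre_iff_of_eq_two_mul hn2 isUnit_one (show (2 : ZMod (2 ^ n)) = 2 * 1 by ring),
    fibre_iff_of_eq_two_mul hn2 isUnit_one.neg (show (-2 : ZMod (2 ^ n)) = 2 * -1 by ring), ← hN₁, n1, n2, n3, n4, n5, n6,
    ite_or_eq_add' d1, ite_or_eq_add' d2]
  omega

/-- **`H_{(2, N₂−1, 3N₂−1)} = H_{(N₁−2, 1, N₁+1)}` for every `n ≥ 3`** — the pair "`(N₁ − 2, 1, N₁ + 1)`, `(2, N₂ − 1, 3N₂ − 1)`" of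
list (3); equivalently `N₂ − 1` stabilises `H_{(N₁−2,1,N₁+1)}` (`(N₂−1)·(N₁−2, 1, N₁+1) = (2, N₂−1, 3N₂−1)`).  By the parity criterion —
indeed the two multiplicity functions COINCIDE: the fibre of `N₁ − 2 = 2(N₂ − 1)` is `{N₂ − 1, 3N₂ − 1}` and that of `2` is `{1, 1 + N₁}`.
[cite: KoblitzRohrlich1978, §5 Proposition, list (3) (p. 1200)] -/
theorem fermatCMType_twoPow_a_stabiliser (hn : 3 ≤ n) :
    fermatCMType (2 ^ n) 2 ((2 : ZMod (2 ^ n)) ^ (n - 2) - 1) (3 * (2 : ZMod (2 ^ n)) ^ (n - 2) - 1) =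
      fermatCMType (2 ^ n) ((2 : ZMod (2 ^ n)) ^ (n - 1) - 2) 1 ((2 : ZMod (2 ^ n)) ^ (n - 1) + 1) := by
  classical
  have hn0 : n ≠ 0 := by omega
  have hn2 : 2 ≤ n := by omega
  haveI : Fact (1 < 2 ^ n) := ⟨Nat.one_lt_pow hn0 (by norm_num)⟩
  set N₁ : ZMod (2 ^ n) := (2 : ZMod (2 ^ n)) ^ (n - 1) with hN₁
  set N₂ : ZMod (2 ^ n) := (2 : ZMod (2 ^ n)) ^ (n - 2) with hN₂
  have e2N₁ : 2 * N₁ = 0 := two_mul_pow_pred hn0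
  have e2N₂ : 2 * N₂ = N₁ := two_mul_pow_pred_pred hn2
  have hN₁0 : N₁ ≠ 0 := two_pow_ne_zero_of_lt (by omega)
  have h2N₁ : ZMod.castHom (dvd_pow_self 2 hn0) (ZMod 2) N₁ = 0 := castHom_two_two_pow' hn0 (by omega)
  have h2N₂ : ZMod.castHom (dvd_pow_self 2 hn0) (ZMod 2) N₂ = 0 := castHom_two_two_pow' hn0 (by omega)
  have hc : IsUnit (N₂ - 1) := (isUnit_iff_castHom_two_eq_one hn0 _).2 (by rw [map_sub, map_one, h2N₂, zero_sub]; decide)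
  have hu₁ : IsUnit (N₁ + 1) := (isUnit_iff_castHom_two_eq_one hn0 _).2 (by rw [map_add, map_one, h2N₁, zero_add])
  have h20 : (2 : ZMod (2 ^ n)) ≠ 0 := by
    have h := two_pow_ne_zero_of_lt (n := n) (j := 1) (by omega)
    rwa [pow_one] at h
  have e3 : (3 * N₂ - 1 : ZMod (2 ^ n)) = N₂ - 1 + N₁ := by linear_combination e2N₂
  rw [e3]
  have hc' : IsUnit (N₂ - 1 + N₁) := (isUnit_iff_castHom_two_eq_one hn0 _).2 (by
    rw [map_add, map_sub, map_one, h2N₂, h2N₁, zero_sub, add_zero]; decide)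
  have hr : (N₁ - 2 : ZMod (2 ^ n)) = 2 * (N₂ - 1) := by linear_combination -e2N₂
  have hr0 : (N₁ - 2 : ZMod (2 ^ n)) ≠ 0 := by rw [hr]; exact fun h => h20 (hc.mul_left_eq_zero.mp h)
  refine fermatCMType_eq_of_forall_countP (p := 2) hn0 hr0 one_ne_zero hu₁.ne_zero (by linear_combination e2N₁) h20 hc.ne_zero
    hc'.ne_zero (by linear_combination e2N₂ + e2N₁) fun x _ => ?_
  have d1 : ¬(x = 1 ∧ x = 1 + N₁) := fun ⟨h1, h2⟩ => hN₁0 (by linear_combination h1 - h2)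
  have d2 : ¬(x = N₂ - 1 ∧ x = N₂ - 1 + N₁) := fun ⟨h1, h2⟩ => hN₁0 (by linear_combination h1 - h2)
  have d3 : ¬(-x = 1 ∧ -x = 1 + N₁) := fun ⟨h1, h2⟩ => hN₁0 (by linear_combination h1 - h2)
  have d4 : ¬(-x = N₂ - 1 ∧ -x = N₂ - 1 + N₁) := fun ⟨h1, h2⟩ => hN₁0 (by linear_combination h1 - h2)
  have n1 : (x = N₁ + 1) ↔ (x = 1 + N₁) := by rw [add_comm]
  have n2 : (-x = N₁ + 1) ↔ (-x = 1 + N₁) := by rw [add_comm]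
  simp only [Multiset.insert_eq_cons, ← Multiset.cons_zero, Multiset.countP_cons, Multiset.countP_zero, Nat.cast_ofNat,
    fibre_iff_of_isUnit hn0 isUnit_one, fibre_iff_of_isUnit hn0 hu₁, fibre_iff_of_isUnit hn0 hc, fibre_iff_of_isUnit hn0 hc',
    fibre_iff_of_eq_two_mul hn2 isUnit_one (show (2 : ZMod (2 ^ n)) = 2 * 1 by ring), fibre_iff_of_eq_two_mul hn2 hc hr, ← hN₁,
    n1, n2, ite_or_eq_add' d1, ite_or_eq_add' d2, ite_or_eq_add' d3, ite_or_eq_add' d4]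
  omega

end Stabilisers

/-! ## §2 The seven pairs have equal `H` for every `n ≥ 3`; THEOREM 4 ∕ the §5 PROPOSITION AS AN EQUIVALENCE (`n ≥ 4`) -/

section Pairs

variable {n : ℕ}

/-- Cyclic rotation of a triple (private copy). [folklore] -/
private theorem triple_rotate' {N : ℕ} (a b c : ZMod N) : ({a, b, c} : Multiset (ZMod N)) = {c, a, b} := by
  rw [Multiset.pair_comm b c, Multiset.insert_eq_cons, Multiset.insert_eq_cons, Multiset.insert_eq_cons, Multiset.insert_eq_cons,
    Multiset.cons_swap]

/-- Transposition of the first two entries of a triple (private copy). [folklore] -/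
private theorem triple_swap_left' {N : ℕ} (a b c : ZMod N) : ({a, b, c} : Multiset (ZMod N)) = {b, a, c} := by
  rw [Multiset.insert_eq_cons, Multiset.insert_eq_cons, Multiset.insert_eq_cons, Multiset.insert_eq_cons, Multiset.cons_swap]

/-- Pair (1): `H_{(N₁−2, N₁−1, 3)} = H_{(N−4, 1, 3)}` (`n ≥ 3`; the sibling's `fermatCMType_twoPow_d` = Theorem 4 d)₀, respelled).
[cite: KoblitzRohrlich1978, §5 Proposition (1) (p. 1200); Theorem 4 d) (p. 1186)] -/
private theorem pair₁ (hn : 3 ≤ n) : fermatCMType (2 ^ n) ((2 : ZMod (2 ^ n)) ^ (n - 1) - 2) ((2 : ZMod (2 ^ n)) ^ (n - 1) - 1) 3 = fermatCMType (2 ^ n) (-4) 1 3 := by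
  have h := fermatCMType_twoPow_d hn
  rw [neg_add_eq_sub, neg_add_eq_sub] at h
  exact (fermatCMType_eq_of_multiset_eq (triple_rotate' _ _ _)).trans (h.trans (fermatCMType_eq_of_multiset_eq (triple_rotate' _ _ _)))

/-- Pair (2)(i): `H_{(N₁, 1, N₁−1)} = H_{(N−2, 1, 1)}` (`n ≥ 3`; the sibling's `fermatCMType_twoPow_e` = Theorem 4 e)₀, respelled).
[cite: KoblitzRohrlich1978, §5 Proposition (2) (p. 1200); Theorem 4 e) (p. 1186)] -/
private theorem pair₂ (hn : 3 ≤ n) : fermatCMType (2 ^ n) ((2 : ZMod (2 ^ n)) ^ (n - 1)) 1 ((2 : ZMod (2 ^ n)) ^ (n - 1) - 1) = fermatCMType (2 ^ n) (-2) 1 1 := by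
  have h := fermatCMType_twoPow_e hn
  rw [neg_add_eq_sub] at h
  exact (fermatCMType_eq_of_multiset_eq (triple_rotate' _ _ _).symm).trans
    (h.trans (fermatCMType_eq_of_multiset_eq (triple_rotate' _ _ _)))

/-- Pair (2)(ii): `H_{(2, N₁−1, N₁−1)} = H_{(N−2, 1, 1)}` (`n ≥ 3`; §1). [cite: KoblitzRohrlich1978, §5 Proposition (2) (p. 1200)] -/
private theorem pair₃ (hn : 3 ≤ n) : fermatCMType (2 ^ n) 2 ((2 : ZMod (2 ^ n)) ^ (n - 1) - 1) ((2 : ZMod (2 ^ n)) ^ (n - 1) - 1) = fermatCMType (2 ^ n) (-2) 1 1 :=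
  fermatCMType_twoPow_e_stabiliser hn

/-- Pair (3)(i): `H_{(N−4, 2, 2)} = H_{(N₁−2, 1, N₁+1)}` (`n ≥ 3`; the sibling's `fermatCMType_twoPow_a_e₁` = "Furthermore" at `m = 0`,
respelled). [cite: KoblitzRohrlich1978, §5 Proposition (3) (p. 1200); Theorem 4 a), "Furthermore" (p. 1186)] -/
private theorem pair₄ (hn : 3 ≤ n) : fermatCMType (2 ^ n) (-4) 2 2 = fermatCMType (2 ^ n) ((2 : ZMod (2 ^ n)) ^ (n - 1) - 2) 1 ((2 : ZMod (2 ^ n)) ^ (n - 1) + 1) := by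
  have h := fermatCMType_twoPow_a_e₁ hn
  rw [neg_add_eq_sub, add_comm (1 : ZMod (2 ^ n))] at h
  exact (fermatCMType_eq_of_multiset_eq (triple_rotate' _ _ _).symm).trans (h.trans (fermatCMType_eq_of_multiset_eq (triple_swap_left' _ _ _)))

/-- Pair (3)(ii): `H_{(2, N₂−1, 3N₂−1)} = H_{(N₁−2, 1, N₁+1)}` (`n ≥ 3`; §1). [cite: KoblitzRohrlich1978, §5 Proposition (3) (p. 1200)] -/
private theorem pair₅ (hn : 3 ≤ n) : fermatCMType (2 ^ n) 2 ((2 : ZMod (2 ^ n)) ^ (n - 2) - 1) (3 * (2 : ZMod (2 ^ n)) ^ (n - 2) - 1) = fermatCMType (2 ^ n) ((2 : ZMod (2 ^ n)) ^ (n - 1) - 2) 1 ((2 : ZMod (2 ^ n)) ^ (n - 1) + 1) :=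
  fermatCMType_twoPow_a_stabiliser hn

/-- Pair (3)(iii): `H_{(N₁, 2, N₁−2)} = H_{(N₁−2, 1, N₁+1)}` (`n ≥ 3`; the sibling's `fermatCMType_twoPow_a_e₁'`, respelled).
[cite: KoblitzRohrlich1978, §5 Proposition (3) (p. 1200); Theorem 4 a)₀–e)₁ (p. 1186)] -/
private theorem pair₆ (hn : 3 ≤ n) : fermatCMType (2 ^ n) ((2 : ZMod (2 ^ n)) ^ (n - 1)) 2 ((2 : ZMod (2 ^ n)) ^ (n - 1) - 2) = fermatCMType (2 ^ n) ((2 : ZMod (2 ^ n)) ^ (n - 1) - 2) 1 ((2 : ZMod (2 ^ n)) ^ (n - 1) + 1) := by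
  have h := fermatCMType_twoPow_a_e₁' hn
  rw [neg_add_eq_sub, add_comm (1 : ZMod (2 ^ n))] at h
  exact (fermatCMType_eq_of_multiset_eq (triple_rotate' _ _ _).symm).trans (h.trans (fermatCMType_eq_of_multiset_eq (triple_swap_left' _ _ _)))

/-- Pair (3)(iv): `H_{(N−4, 2, 2)} = H_{(2, N₂−1, 3N₂−1)}` (`n ≥ 3`; (3)(i) and (3)(ii)). [cite: KoblitzRohrlich1978, §5 Proposition (3) (p. 1200)] -/
private theorem pair₇ (hn : 3 ≤ n) : fermatCMType (2 ^ n) (-4) 2 2 = fermatCMType (2 ^ n) 2 ((2 : ZMod (2 ^ n)) ^ (n - 2) - 1) (3 * (2 : ZMod (2 ^ n)) ^ (n - 2) - 1) :=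
  (pair₄ hn).trans (pair₅ hn).symm

/-- **The seven pairs have equal `H` for every `n ≥ 3`**: `H_{(N₁−2,N₁−1,3)} = H_{(N−4,1,3)}`; `H_{(N₁,1,N₁−1)} = H_{(N−2,1,1)} =
H_{(2,N₁−1,N₁−1)}`; `H_{(N−4,2,2)} = H_{(2,N₂−1,3N₂−1)} = H_{(N₁,2,N₁−2)} = H_{(N₁−2,1,N₁+1)}` — lists (1), (2), (3) of the §5
Proposition, i.e. Theorem 4 d)₀, e)₀, the stabiliser `N₁ − 1` of e)₀, "Furthermore"₀ = a)₀∕b)₀ with e)₁, the stabiliser `N₂ − 1`, and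
c)₀ (the siblings `…TwoPowerLevelCoincidences`, `…Furthermore`, `…Families` and §1, in the vocabulary of
`perm_or_exceptional_of_fermatCMType_eq_twoPow`). [cite: KoblitzRohrlich1978, §5 Proposition (1)–(3) (p. 1200); Theorem 4 (p. 1186)] -/
theorem fermatCMType_eq_of_exceptional_pairs_twoPow (hn : 3 ≤ n) :
    fermatCMType (2 ^ n) ((2 : ZMod (2 ^ n)) ^ (n - 1) - 2) ((2 : ZMod (2 ^ n)) ^ (n - 1) - 1) 3 = fermatCMType (2 ^ n) (-4) 1 3 ∧
      fermatCMType (2 ^ n) ((2 : ZMod (2 ^ n)) ^ (n - 1)) 1 ((2 : ZMod (2 ^ n)) ^ (n - 1) - 1) = fermatCMType (2 ^ n) (-2) 1 1 ∧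
      fermatCMType (2 ^ n) 2 ((2 : ZMod (2 ^ n)) ^ (n - 1) - 1) ((2 : ZMod (2 ^ n)) ^ (n - 1) - 1) = fermatCMType (2 ^ n) (-2) 1 1 ∧
      fermatCMType (2 ^ n) (-4) 2 2 = fermatCMType (2 ^ n) ((2 : ZMod (2 ^ n)) ^ (n - 1) - 2) 1 ((2 : ZMod (2 ^ n)) ^ (n - 1) + 1) ∧
      fermatCMType (2 ^ n) 2 ((2 : ZMod (2 ^ n)) ^ (n - 2) - 1) (3 * (2 : ZMod (2 ^ n)) ^ (n - 2) - 1) = fermatCMType (2 ^ n) ((2 : ZMod (2 ^ n)) ^ (n - 1) - 2) 1 ((2 : ZMod (2 ^ n)) ^ (n - 1) + 1) ∧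
      fermatCMType (2 ^ n) ((2 : ZMod (2 ^ n)) ^ (n - 1)) 2 ((2 : ZMod (2 ^ n)) ^ (n - 1) - 2) = fermatCMType (2 ^ n) ((2 : ZMod (2 ^ n)) ^ (n - 1) - 2) 1 ((2 : ZMod (2 ^ n)) ^ (n - 1) + 1) ∧
      fermatCMType (2 ^ n) (-4) 2 2 = fermatCMType (2 ^ n) 2 ((2 : ZMod (2 ^ n)) ^ (n - 2) - 1) (3 * (2 : ZMod (2 ^ n)) ^ (n - 2) - 1) :=
  ⟨pair₁ hn, pair₂ hn, pair₃ hn, pair₄ hn, pair₅ hn, pair₆ hn, pair₇ hn⟩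

/-- **THEOREM 4 ∕ the §5 PROPOSITION AS AN EQUIVALENCE at `N = 2ⁿ`, `n ≥ 4`.**  "PROPOSITION. Let `N = 2ⁿ`, `n ≥ 4`. Let `N₁ = 2ⁿ⁻¹`,
`N₂ = 2ⁿ⁻²`, `τ = (r, s, t)`, `τ′ = (r′, s′, t′)`, `H_τ = H_{τ′}`. Suppose that `τ′` is not a permutation of `τ`, and that
g.c.d.`(r, s, t, r′, s′, t′) = 1`. Then for some `u ∈ (ℤ/Nℤ)*`, `uτ` and `uτ′` are permutations of one of the following pairs of triples:
(1) `(N − 4, 1, 3)`, `(N₁ − 2, N₁ − 1, 3)`; (2) any 2 of the triples `(N − 2, 1, 1)`, `(N₁, 1, N₁ − 1)`, `(2, N₁ − 1, N₁ − 1)`; (3) any 2 of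
the triples `(N − 4, 2, 2)`, `(N₁, 2, N₁ − 2)`, `(N₁ − 2, 1, N₁ + 1)`, `(2, N₂ − 1, 3N₂ − 1)`."  Tree form, both directions: for triples of
non-zero residues modulo `2ⁿ` (`n ≥ 4`) with `r + s + t = 0 = r′ + s′ + t′` and a unit among the six entries, **`H_{τ′} = H_τ` iff
`{r′,s′,t′} = {r,s,t}` or, for a unit `w`, `({wr,ws,wt}, {wr′,ws′,wt′})` is one of the seven pairs of
`perm_or_exceptional_of_fermatCMType_eq_twoPow` in either order** ("⟹" is that theorem; "⟸" is `fermatCMType_eq_of_exceptional_pairs_twoPow`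
and `H_{wτ′} = H_{wτ} ⟺ H_{τ′} = H_τ`). [cite: KoblitzRohrlich1978, §5 Proposition (p. 1200); Theorem 4 (p. 1186); §1 (p. 1185)] -/
theorem fermatCMType_eq_iff_perm_or_exceptional_twoPow (hn : 4 ≤ n) {r s t r' s' t' : ZMod (2 ^ n)}
    (hr0 : r ≠ 0) (hs0 : s ≠ 0) (ht0 : t ≠ 0) (hrst : r + s + t = 0)
    (hr'0 : r' ≠ 0) (hs'0 : s' ≠ 0) (ht'0 : t' ≠ 0) (hrst' : r' + s' + t' = 0)
    (hunit : IsUnit r ∨ IsUnit s ∨ IsUnit t ∨ IsUnit r' ∨ IsUnit s' ∨ IsUnit t') :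
    fermatCMType (2 ^ n) r' s' t' = fermatCMType (2 ^ n) r s t ↔
    (({r', s', t'} : Multiset (ZMod (2 ^ n))) = {r, s, t} ∨
      ∃ w : ZMod (2 ^ n), IsUnit w ∧
        (((({w * r, w * s, w * t} : Multiset (ZMod (2 ^ n))) = {-4, 1, 3} ∧
            ({w * r', w * s', w * t'} : Multiset (ZMod (2 ^ n))) = {(2 : ZMod (2 ^ n)) ^ (n - 1) - 2, (2 : ZMod (2 ^ n)) ^ (n - 1) - 1, 3}) ∨
          (({w * r, w * s, w * t} : Multiset (ZMod (2 ^ n))) = {(2 : ZMod (2 ^ n)) ^ (n - 1) - 2, (2 : ZMod (2 ^ n)) ^ (n - 1) - 1, 3} ∧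
            ({w * r', w * s', w * t'} : Multiset (ZMod (2 ^ n))) = {-4, 1, 3})) ∨
        ((({w * r, w * s, w * t} : Multiset (ZMod (2 ^ n))) = {-2, 1, 1} ∧
            ({w * r', w * s', w * t'} : Multiset (ZMod (2 ^ n))) = {(2 : ZMod (2 ^ n)) ^ (n - 1), 1, (2 : ZMod (2 ^ n)) ^ (n - 1) - 1}) ∨
          (({w * r, w * s, w * t} : Multiset (ZMod (2 ^ n))) = {(2 : ZMod (2 ^ n)) ^ (n - 1), 1, (2 : ZMod (2 ^ n)) ^ (n - 1) - 1} ∧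
            ({w * r', w * s', w * t'} : Multiset (ZMod (2 ^ n))) = {-2, 1, 1})) ∨
        ((({w * r, w * s, w * t} : Multiset (ZMod (2 ^ n))) = {-2, 1, 1} ∧
            ({w * r', w * s', w * t'} : Multiset (ZMod (2 ^ n))) = {2, (2 : ZMod (2 ^ n)) ^ (n - 1) - 1, (2 : ZMod (2 ^ n)) ^ (n - 1) - 1}) ∨
          (({w * r, w * s, w * t} : Multiset (ZMod (2 ^ n))) = {2, (2 : ZMod (2 ^ n)) ^ (n - 1) - 1, (2 : ZMod (2 ^ n)) ^ (n - 1) - 1} ∧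
            ({w * r', w * s', w * t'} : Multiset (ZMod (2 ^ n))) = {-2, 1, 1})) ∨
        ((({w * r, w * s, w * t} : Multiset (ZMod (2 ^ n))) = {(2 : ZMod (2 ^ n)) ^ (n - 1) - 2, 1, (2 : ZMod (2 ^ n)) ^ (n - 1) + 1} ∧
            ({w * r', w * s', w * t'} : Multiset (ZMod (2 ^ n))) = {-4, 2, 2}) ∨
          (({w * r, w * s, w * t} : Multiset (ZMod (2 ^ n))) = {-4, 2, 2} ∧
            ({w * r', w * s', w * t'} : Multiset (ZMod (2 ^ n))) = {(2 : ZMod (2 ^ n)) ^ (n - 1) - 2, 1, (2 : ZMod (2 ^ n)) ^ (n - 1) + 1})) ∨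
        ((({w * r, w * s, w * t} : Multiset (ZMod (2 ^ n))) = {(2 : ZMod (2 ^ n)) ^ (n - 1) - 2, 1, (2 : ZMod (2 ^ n)) ^ (n - 1) + 1} ∧
            ({w * r', w * s', w * t'} : Multiset (ZMod (2 ^ n))) = {2, (2 : ZMod (2 ^ n)) ^ (n - 2) - 1, 3 * (2 : ZMod (2 ^ n)) ^ (n - 2) - 1}) ∨
          (({w * r, w * s, w * t} : Multiset (ZMod (2 ^ n))) = {2, (2 : ZMod (2 ^ n)) ^ (n - 2) - 1, 3 * (2 : ZMod (2 ^ n)) ^ (n - 2) - 1} ∧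
            ({w * r', w * s', w * t'} : Multiset (ZMod (2 ^ n))) = {(2 : ZMod (2 ^ n)) ^ (n - 1) - 2, 1, (2 : ZMod (2 ^ n)) ^ (n - 1) + 1})) ∨
        ((({w * r, w * s, w * t} : Multiset (ZMod (2 ^ n))) = {(2 : ZMod (2 ^ n)) ^ (n - 1) - 2, 1, (2 : ZMod (2 ^ n)) ^ (n - 1) + 1} ∧
            ({w * r', w * s', w * t'} : Multiset (ZMod (2 ^ n))) = {(2 : ZMod (2 ^ n)) ^ (n - 1), 2, (2 : ZMod (2 ^ n)) ^ (n - 1) - 2}) ∨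
          (({w * r, w * s, w * t} : Multiset (ZMod (2 ^ n))) = {(2 : ZMod (2 ^ n)) ^ (n - 1), 2, (2 : ZMod (2 ^ n)) ^ (n - 1) - 2} ∧
            ({w * r', w * s', w * t'} : Multiset (ZMod (2 ^ n))) = {(2 : ZMod (2 ^ n)) ^ (n - 1) - 2, 1, (2 : ZMod (2 ^ n)) ^ (n - 1) + 1})) ∨
        ((({w * r, w * s, w * t} : Multiset (ZMod (2 ^ n))) = {2, (2 : ZMod (2 ^ n)) ^ (n - 2) - 1, 3 * (2 : ZMod (2 ^ n)) ^ (n - 2) - 1} ∧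
            ({w * r', w * s', w * t'} : Multiset (ZMod (2 ^ n))) = {-4, 2, 2}) ∨
          (({w * r, w * s, w * t} : Multiset (ZMod (2 ^ n))) = {-4, 2, 2} ∧
            ({w * r', w * s', w * t'} : Multiset (ZMod (2 ^ n))) = {2, (2 : ZMod (2 ^ n)) ^ (n - 2) - 1, 3 * (2 : ZMod (2 ^ n)) ^ (n - 2) - 1})))) := by
  refine ⟨perm_or_exceptional_of_fermatCMType_eq_twoPow hn hr0 hs0 ht0 hrst hr'0 hs'0 ht'0 hrst' hunit, ?_⟩
  have hn3 : 3 ≤ n := by omega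
  rintro (hperm | ⟨w, hw, h⟩)
  · exact fermatCMType_eq_of_multiset_eq hperm
  · rcases h with (⟨hτ, hτ'⟩ | ⟨hτ, hτ'⟩) | (⟨hτ, hτ'⟩ | ⟨hτ, hτ'⟩) | (⟨hτ, hτ'⟩ | ⟨hτ, hτ'⟩) | (⟨hτ, hτ'⟩ | ⟨hτ, hτ'⟩) |
      (⟨hτ, hτ'⟩ | ⟨hτ, hτ'⟩) | (⟨hτ, hτ'⟩ | ⟨hτ, hτ'⟩) | (⟨hτ, hτ'⟩ | ⟨hτ, hτ'⟩)
    · exact (fermatCMType_mul_eq_mul_iff hw).1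
        ((fermatCMType_eq_of_multiset_eq hτ').trans ((pair₁ hn3).trans (fermatCMType_eq_of_multiset_eq hτ).symm))
    · exact (fermatCMType_mul_eq_mul_iff hw).1
        ((fermatCMType_eq_of_multiset_eq hτ').trans ((pair₁ hn3).symm.trans (fermatCMType_eq_of_multiset_eq hτ).symm))
    · exact (fermatCMType_mul_eq_mul_iff hw).1
        ((fermatCMType_eq_of_multiset_eq hτ').trans ((pair₂ hn3).trans (fermatCMType_eq_of_multiset_eq hτ).symm))
    · exact (fermatCMType_mul_eq_mul_iff hw).1
        ((fermatCMType_eq_of_multiset_eq hτ').trans ((pair₂ hn3).symm.trans (fermatCMType_eq_of_multiset_eq hτ).symm))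
    · exact (fermatCMType_mul_eq_mul_iff hw).1
        ((fermatCMType_eq_of_multiset_eq hτ').trans ((pair₃ hn3).trans (fermatCMType_eq_of_multiset_eq hτ).symm))
    · exact (fermatCMType_mul_eq_mul_iff hw).1
        ((fermatCMType_eq_of_multiset_eq hτ').trans ((pair₃ hn3).symm.trans (fermatCMType_eq_of_multiset_eq hτ).symm))
    · exact (fermatCMType_mul_eq_mul_iff hw).1
        ((fermatCMType_eq_of_multiset_eq hτ').trans ((pair₄ hn3).trans (fermatCMType_eq_of_multiset_eq hτ).symm))
    · exact (fermatCMType_mul_eq_mul_iff hw).1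
        ((fermatCMType_eq_of_multiset_eq hτ').trans ((pair₄ hn3).symm.trans (fermatCMType_eq_of_multiset_eq hτ).symm))
    · exact (fermatCMType_mul_eq_mul_iff hw).1
        ((fermatCMType_eq_of_multiset_eq hτ').trans ((pair₅ hn3).trans (fermatCMType_eq_of_multiset_eq hτ).symm))
    · exact (fermatCMType_mul_eq_mul_iff hw).1
        ((fermatCMType_eq_of_multiset_eq hτ').trans ((pair₅ hn3).symm.trans (fermatCMType_eq_of_multiset_eq hτ).symm))
    · exact (fermatCMType_mul_eq_mul_iff hw).1
        ((fermatCMType_eq_of_multiset_eq hτ').trans ((pair₆ hn3).trans (fermatCMType_eq_of_multiset_eq hτ).symm))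
    · exact (fermatCMType_mul_eq_mul_iff hw).1
        ((fermatCMType_eq_of_multiset_eq hτ').trans ((pair₆ hn3).symm.trans (fermatCMType_eq_of_multiset_eq hτ).symm))
    · exact (fermatCMType_mul_eq_mul_iff hw).1
        ((fermatCMType_eq_of_multiset_eq hτ').trans ((pair₇ hn3).trans (fermatCMType_eq_of_multiset_eq hτ).symm))
    · exact (fermatCMType_mul_eq_mul_iff hw).1
        ((fermatCMType_eq_of_multiset_eq hτ').trans ((pair₇ hn3).symm.trans (fermatCMType_eq_of_multiset_eq hτ).symm))

/-- **The §5 PROPOSITION AS PRINTED (ten unordered pairs)**: under the hypotheses of the Proposition — `n ≥ 4`, non-zero residues,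
`r + s + t = 0 = r′ + s′ + t′`, g.c.d. `= 1` (a unit among the six entries), `H_{τ′} = H_τ`, `τ′` NOT a permutation of `τ` — there is a unit
`u` such that `uτ` and `uτ′` are permutations of the two members of ONE of K–R's pairs: (1) `(N − 4, 1, 3)`, `(N₁ − 2, N₁ − 1, 3)`; (2) two
(different) triples among `(N − 2, 1, 1)`, `(N₁, 1, N₁ − 1)`, `(2, N₁ − 1, N₁ − 1)`; (3) two (different) triples among `(N − 4, 2, 2)`,
`(N₁, 2, N₁ − 2)`, `(N₁ − 2, 1, N₁ + 1)`, `(2, N₂ − 1, 3N₂ − 1)` (`N − 4 = −4`, `N − 2 = −2` as residues; "different" is `{uτ} ≠ {uτ′}`).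
A weakening of `perm_or_exceptional_of_fermatCMType_eq_twoPow` (seven of the ten pairs occur). [cite: KoblitzRohrlich1978, §5 Proposition (p. 1200)] -/
theorem exists_unit_printed_pair_of_fermatCMType_eq_twoPow (hn : 4 ≤ n) {r s t r' s' t' : ZMod (2 ^ n)}
    (hr0 : r ≠ 0) (hs0 : s ≠ 0) (ht0 : t ≠ 0) (hrst : r + s + t = 0)
    (hr'0 : r' ≠ 0) (hs'0 : s' ≠ 0) (ht'0 : t' ≠ 0) (hrst' : r' + s' + t' = 0)
    (hunit : IsUnit r ∨ IsUnit s ∨ IsUnit t ∨ IsUnit r' ∨ IsUnit s' ∨ IsUnit t')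
    (heq : fermatCMType (2 ^ n) r' s' t' = fermatCMType (2 ^ n) r s t)
    (hperm : ({r', s', t'} : Multiset (ZMod (2 ^ n))) ≠ {r, s, t}) :
    ∃ u : ZMod (2 ^ n), IsUnit u ∧ ({u * r, u * s, u * t} : Multiset (ZMod (2 ^ n))) ≠ ({u * r', u * s', u * t'} : Multiset (ZMod (2 ^ n))) ∧
      ((({u * r, u * s, u * t} : Multiset (ZMod (2 ^ n))) = {-4, 1, 3} ∧
          ({u * r', u * s', u * t'} : Multiset (ZMod (2 ^ n))) = {(2 : ZMod (2 ^ n)) ^ (n - 1) - 2, (2 : ZMod (2 ^ n)) ^ (n - 1) - 1, 3}) ∨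
        (({u * r, u * s, u * t} : Multiset (ZMod (2 ^ n))) = {(2 : ZMod (2 ^ n)) ^ (n - 1) - 2, (2 : ZMod (2 ^ n)) ^ (n - 1) - 1, 3} ∧
          ({u * r', u * s', u * t'} : Multiset (ZMod (2 ^ n))) = {-4, 1, 3}) ∨
        (({u * r, u * s, u * t} : Multiset (ZMod (2 ^ n))) ∈
            ([{-2, 1, 1}, {(2 : ZMod (2 ^ n)) ^ (n - 1), 1, (2 : ZMod (2 ^ n)) ^ (n - 1) - 1}, {2, (2 : ZMod (2 ^ n)) ^ (n - 1) - 1, (2 : ZMod (2 ^ n)) ^ (n - 1) - 1}] : List (Multiset (ZMod (2 ^ n)))) ∧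
          ({u * r', u * s', u * t'} : Multiset (ZMod (2 ^ n))) ∈
            ([{-2, 1, 1}, {(2 : ZMod (2 ^ n)) ^ (n - 1), 1, (2 : ZMod (2 ^ n)) ^ (n - 1) - 1}, {2, (2 : ZMod (2 ^ n)) ^ (n - 1) - 1, (2 : ZMod (2 ^ n)) ^ (n - 1) - 1}] : List (Multiset (ZMod (2 ^ n))))) ∨
        (({u * r, u * s, u * t} : Multiset (ZMod (2 ^ n))) ∈
            ([{-4, 2, 2}, {(2 : ZMod (2 ^ n)) ^ (n - 1), 2, (2 : ZMod (2 ^ n)) ^ (n - 1) - 2}, {(2 : ZMod (2 ^ n)) ^ (n - 1) - 2, 1, (2 : ZMod (2 ^ n)) ^ (n - 1) + 1}, {2, (2 : ZMod (2 ^ n)) ^ (n - 2) - 1, 3 * (2 : ZMod (2 ^ n)) ^ (n - 2) - 1}] : List (Multiset (ZMod (2 ^ n)))) ∧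
          ({u * r', u * s', u * t'} : Multiset (ZMod (2 ^ n))) ∈
            ([{-4, 2, 2}, {(2 : ZMod (2 ^ n)) ^ (n - 1), 2, (2 : ZMod (2 ^ n)) ^ (n - 1) - 2}, {(2 : ZMod (2 ^ n)) ^ (n - 1) - 2, 1, (2 : ZMod (2 ^ n)) ^ (n - 1) + 1}, {2, (2 : ZMod (2 ^ n)) ^ (n - 2) - 1, 3 * (2 : ZMod (2 ^ n)) ^ (n - 2) - 1}] : List (Multiset (ZMod (2 ^ n)))))) := by
  rcases perm_or_exceptional_of_fermatCMType_eq_twoPow hn hr0 hs0 ht0 hrst hr'0 hs'0 ht'0 hrst' hunit heq with h | ⟨w, hw, h⟩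
  · exact absurd h hperm
  refine ⟨w, hw, fun e => hperm ?_, ?_⟩
  · obtain ⟨wi, hwi⟩ := hw.exists_left_inv
    have e' := congrArg (Multiset.map fun v => wi * v) e
    simp only [Multiset.insert_eq_cons, Multiset.map_cons, Multiset.map_singleton, ← mul_assoc, hwi, one_mul] at e'
    simpa only [Multiset.insert_eq_cons] using e'.symm
  · rcases h with (⟨hτ, hτ'⟩ | ⟨hτ, hτ'⟩) | (⟨hτ, hτ'⟩ | ⟨hτ, hτ'⟩) | (⟨hτ, hτ'⟩ | ⟨hτ, hτ'⟩) | (⟨hτ, hτ'⟩ | ⟨hτ, hτ'⟩) |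
      (⟨hτ, hτ'⟩ | ⟨hτ, hτ'⟩) | (⟨hτ, hτ'⟩ | ⟨hτ, hτ'⟩) | (⟨hτ, hτ'⟩ | ⟨hτ, hτ'⟩) <;> rw [hτ, hτ'] <;> simp

end Pairs

/-! ## §3 THEOREM 4 ON ABELIAN VARIETIES (`N = 2ⁿ`, `n ≥ 4`): the translate form, the isogeny criterion, non-vacuity -/

section AbelianVarieties

open CategoryTheory
open Literature.AlgebraicGeometry.Motives (AbelianVariety)
open Literature.AlgebraicGeometry.HodgeTheory
open CyclotomicCMTypeResidueSets (unitResidues IsCMResidueSet)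

variable {n : ℕ}

/-- Multiplying an admissible pair through by a unit keeps it admissible (private copy of the sibling's helper). [folklore] -/
private theorem triple_mul_admissible' {M : ℕ} {u r s t r' s' t' : ZMod M} (hu : IsUnit u) (hr0 : r ≠ 0) (hs0 : s ≠ 0)
    (ht0 : t ≠ 0) (hrst : r + s + t = 0) (hunit : IsUnit r ∨ IsUnit s ∨ IsUnit t ∨ IsUnit r' ∨ IsUnit s' ∨ IsUnit t') :
    u * r ≠ 0 ∧ u * s ≠ 0 ∧ u * t ≠ 0 ∧ u * r + u * s + u * t = 0 ∧
      (IsUnit (u * r) ∨ IsUnit (u * s) ∨ IsUnit (u * t) ∨ IsUnit r' ∨ IsUnit s' ∨ IsUnit t') := by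
  refine ⟨fun h => hr0 (hu.mul_right_eq_zero.mp h), fun h => hs0 (hu.mul_right_eq_zero.mp h),
    fun h => ht0 (hu.mul_right_eq_zero.mp h), by rw [← mul_add, ← mul_add, hrst, mul_zero], ?_⟩
  rcases hunit with h | h | h | h
  · exact Or.inl (hu.mul h)
  · exact Or.inr (Or.inl (hu.mul h))
  · exact Or.inr (Or.inr (Or.inl (hu.mul h)))
  · exact Or.inr (Or.inr (Or.inr h))

/-- **The translate form at `N = 2ⁿ`, `n ≥ 4`**: for a unit `u`, `(∀ x, x ∈ H_{τ′} ↔ ux ∈ H_τ)` iff `{τ′} = {uτ}` or, for a unit `w`,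
`(w·uτ, wτ′)` is one of the seven pairs in either order ("`hH_{r,s} = H_{r′,s′}` for some `h`").
[cite: KoblitzRohrlich1978, §5 Proposition (p. 1200), Theorem 4 (p. 1186), §1 (p. 1184)] -/
theorem forall_mem_fermatCMType_iff_iff_perm_or_exceptional_twoPow (hn : 4 ≤ n) {r s t r' s' t' u : ZMod (2 ^ n)}
    (hr0 : r ≠ 0) (hs0 : s ≠ 0) (ht0 : t ≠ 0) (hrst : r + s + t = 0)
    (hr'0 : r' ≠ 0) (hs'0 : s' ≠ 0) (ht'0 : t' ≠ 0) (hrst' : r' + s' + t' = 0)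
    (hunit : IsUnit r ∨ IsUnit s ∨ IsUnit t ∨ IsUnit r' ∨ IsUnit s' ∨ IsUnit t') (hu : IsUnit u) :
    (∀ x, x ∈ fermatCMType (2 ^ n) r' s' t' ↔ u * x ∈ fermatCMType (2 ^ n) r s t) ↔
    (({r', s', t'} : Multiset (ZMod (2 ^ n))) = {(u * r), (u * s), (u * t)} ∨
      ∃ w : ZMod (2 ^ n), IsUnit w ∧
          (((({w * (u * r), w * (u * s), w * (u * t)} : Multiset (ZMod (2 ^ n))) = {-4, 1, 3} ∧
              ({w * r', w * s', w * t'} : Multiset (ZMod (2 ^ n))) = {(2 : ZMod (2 ^ n)) ^ (n - 1) - 2, (2 : ZMod (2 ^ n)) ^ (n - 1) - 1, 3}) ∨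
            (({w * (u * r), w * (u * s), w * (u * t)} : Multiset (ZMod (2 ^ n))) = {(2 : ZMod (2 ^ n)) ^ (n - 1) - 2, (2 : ZMod (2 ^ n)) ^ (n - 1) - 1, 3} ∧
              ({w * r', w * s', w * t'} : Multiset (ZMod (2 ^ n))) = {-4, 1, 3})) ∨
          ((({w * (u * r), w * (u * s), w * (u * t)} : Multiset (ZMod (2 ^ n))) = {-2, 1, 1} ∧
              ({w * r', w * s', w * t'} : Multiset (ZMod (2 ^ n))) = {(2 : ZMod (2 ^ n)) ^ (n - 1), 1, (2 : ZMod (2 ^ n)) ^ (n - 1) - 1}) ∨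
            (({w * (u * r), w * (u * s), w * (u * t)} : Multiset (ZMod (2 ^ n))) = {(2 : ZMod (2 ^ n)) ^ (n - 1), 1, (2 : ZMod (2 ^ n)) ^ (n - 1) - 1} ∧
              ({w * r', w * s', w * t'} : Multiset (ZMod (2 ^ n))) = {-2, 1, 1})) ∨
          ((({w * (u * r), w * (u * s), w * (u * t)} : Multiset (ZMod (2 ^ n))) = {-2, 1, 1} ∧
              ({w * r', w * s', w * t'} : Multiset (ZMod (2 ^ n))) = {2, (2 : ZMod (2 ^ n)) ^ (n - 1) - 1, (2 : ZMod (2 ^ n)) ^ (n - 1) - 1}) ∨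
            (({w * (u * r), w * (u * s), w * (u * t)} : Multiset (ZMod (2 ^ n))) = {2, (2 : ZMod (2 ^ n)) ^ (n - 1) - 1, (2 : ZMod (2 ^ n)) ^ (n - 1) - 1} ∧
              ({w * r', w * s', w * t'} : Multiset (ZMod (2 ^ n))) = {-2, 1, 1})) ∨
          ((({w * (u * r), w * (u * s), w * (u * t)} : Multiset (ZMod (2 ^ n))) = {(2 : ZMod (2 ^ n)) ^ (n - 1) - 2, 1, (2 : ZMod (2 ^ n)) ^ (n - 1) + 1} ∧
              ({w * r', w * s', w * t'} : Multiset (ZMod (2 ^ n))) = {-4, 2, 2}) ∨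
            (({w * (u * r), w * (u * s), w * (u * t)} : Multiset (ZMod (2 ^ n))) = {-4, 2, 2} ∧
              ({w * r', w * s', w * t'} : Multiset (ZMod (2 ^ n))) = {(2 : ZMod (2 ^ n)) ^ (n - 1) - 2, 1, (2 : ZMod (2 ^ n)) ^ (n - 1) + 1})) ∨
          ((({w * (u * r), w * (u * s), w * (u * t)} : Multiset (ZMod (2 ^ n))) = {(2 : ZMod (2 ^ n)) ^ (n - 1) - 2, 1, (2 : ZMod (2 ^ n)) ^ (n - 1) + 1} ∧
              ({w * r', w * s', w * t'} : Multiset (ZMod (2 ^ n))) = {2, (2 : ZMod (2 ^ n)) ^ (n - 2) - 1, 3 * (2 : ZMod (2 ^ n)) ^ (n - 2) - 1}) ∨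
            (({w * (u * r), w * (u * s), w * (u * t)} : Multiset (ZMod (2 ^ n))) = {2, (2 : ZMod (2 ^ n)) ^ (n - 2) - 1, 3 * (2 : ZMod (2 ^ n)) ^ (n - 2) - 1} ∧
              ({w * r', w * s', w * t'} : Multiset (ZMod (2 ^ n))) = {(2 : ZMod (2 ^ n)) ^ (n - 1) - 2, 1, (2 : ZMod (2 ^ n)) ^ (n - 1) + 1})) ∨
          ((({w * (u * r), w * (u * s), w * (u * t)} : Multiset (ZMod (2 ^ n))) = {(2 : ZMod (2 ^ n)) ^ (n - 1) - 2, 1, (2 : ZMod (2 ^ n)) ^ (n - 1) + 1} ∧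
              ({w * r', w * s', w * t'} : Multiset (ZMod (2 ^ n))) = {(2 : ZMod (2 ^ n)) ^ (n - 1), 2, (2 : ZMod (2 ^ n)) ^ (n - 1) - 2}) ∨
            (({w * (u * r), w * (u * s), w * (u * t)} : Multiset (ZMod (2 ^ n))) = {(2 : ZMod (2 ^ n)) ^ (n - 1), 2, (2 : ZMod (2 ^ n)) ^ (n - 1) - 2} ∧
              ({w * r', w * s', w * t'} : Multiset (ZMod (2 ^ n))) = {(2 : ZMod (2 ^ n)) ^ (n - 1) - 2, 1, (2 : ZMod (2 ^ n)) ^ (n - 1) + 1})) ∨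
          ((({w * (u * r), w * (u * s), w * (u * t)} : Multiset (ZMod (2 ^ n))) = {2, (2 : ZMod (2 ^ n)) ^ (n - 2) - 1, 3 * (2 : ZMod (2 ^ n)) ^ (n - 2) - 1} ∧
              ({w * r', w * s', w * t'} : Multiset (ZMod (2 ^ n))) = {-4, 2, 2}) ∨
            (({w * (u * r), w * (u * s), w * (u * t)} : Multiset (ZMod (2 ^ n))) = {-4, 2, 2} ∧
              ({w * r', w * s', w * t'} : Multiset (ZMod (2 ^ n))) = {2, (2 : ZMod (2 ^ n)) ^ (n - 2) - 1, 3 * (2 : ZMod (2 ^ n)) ^ (n - 2) - 1})))) := by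
  rw [forall_mem_iff_eq_mul hu]
  obtain ⟨h1, h2, h3, h4, h5⟩ := triple_mul_admissible' hu hr0 hs0 ht0 hrst hunit
  exact fermatCMType_eq_iff_perm_or_exceptional_twoPow hn h1 h2 h3 h4 hr'0 hs'0 ht'0 hrst' h5

variable {L : Type} [Field L] [NumberField L] [IsCyclotomicExtension {2 ^ n} ℚ L]
  {A A' : AbelianVariety ℂ} {ι : 𝓞 L →+* End A} {θ : L →+* Module.End ℂ (complexBetti A.X 1)}
  {ι' : 𝓞 L →+* End A'} {θ' : L →+* Module.End ℂ (complexBetti A'.X 1)}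

/-- **KOBLITZ–ROHRLICH THEOREM 4 ON ABELIAN VARIETIES (`N = 2ⁿ`, `n ≥ 4`).**  "THEOREM 4. Suppose `N = 2ⁿ`. Then the only isogenies apart
from the obvious ones are between pairs of lattices corresponding to the triples a) … e)" — here at g.c.d. `= 1` (`m = 0`, one of the two
triples primitive) and in the normal form of the §5 Proposition: for triples `τ = (r,s,t)`, `τ′ = (r′,s′,t′)` of non-zero residues modulo
`2ⁿ` with `r + s + t = 0 = r′ + s′ + t′` and a unit among the six entries, abelian varieties `A`, `A′` of types `Φ_{H_τ}`, `Φ_{H_{τ′}}` of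
`ℚ(ζ_{2ⁿ})` are ISOGENOUS iff for a unit `u`: `{r′,s′,t′} = {ur, us, ut}` (an "obvious" isogeny), or for a further unit `w` the pair
`(w·uτ, wτ′)` is, up to order inside each triple and up to exchanging the two triples, one of `((N−4,1,3), (N₁−2,N₁−1,3))`,
`((N−2,1,1), (N₁,1,N₁−1))`, `((N−2,1,1), (2,N₁−1,N₁−1))`, `((N₁−2,1,N₁+1), (N−4,2,2))`, `((N₁−2,1,N₁+1), (2,N₂−1,3N₂−1))`,
`((N₁−2,1,N₁+1), (N₁,2,N₁−2))`, `((2,N₂−1,3N₂−1), (N−4,2,2))` (Shimura–Taniyama: `A_τ ∼ A_{τ′} ⟺ H_{τ′} = H_{uτ}` for a unit `u`,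
tree `isIsogenous_fermatCMType_iff_exists_eq_mul`, combined with §2).
[cite: KoblitzRohrlich1978, Theorem 4 (p. 1186), §5 Proposition (p. 1200), §1 (p. 1184)] [cite: Shimura1998, §8.4 Example (1) and §6.1 Corollary] -/
theorem isIsogenous_fermatCMType_iff_twoPow [IsCMField L] (hn : 4 ≤ n) {r s t r' s' t' : ZMod (2 ^ n)}
    (hr0 : r ≠ 0) (hs0 : s ≠ 0) (ht0 : t ≠ 0) (hrst : r + s + t = 0)
    (hr'0 : r' ≠ 0) (hs'0 : s' ≠ 0) (ht'0 : t' ≠ 0) (hrst' : r' + s' + t' = 0)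
    (hunit : IsUnit r ∨ IsUnit s ∨ IsUnit t ∨ IsUnit r' ∨ IsUnit s' ∨ IsUnit t')
    (hS : IsCMResidueSet (2 ^ n) (fermatCMType (2 ^ n) r s t))
    (hS' : IsCMResidueSet (2 ^ n) (fermatCMType (2 ^ n) r' s' t'))
    (hA : IsCMTypeRealisation (cmTypeOfResidues (L := L) (fermatCMType (2 ^ n) r s t) hS.cm) A ι θ)
    (hA' : IsCMTypeRealisation (cmTypeOfResidues (L := L) (fermatCMType (2 ^ n) r' s' t') hS'.cm) A' ι' θ') :
    AbelianVariety.IsIsogenous A A' ↔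
      ∃ u : ZMod (2 ^ n), IsUnit u ∧
      (({r', s', t'} : Multiset (ZMod (2 ^ n))) = {(u * r), (u * s), (u * t)} ∨
      ∃ w : ZMod (2 ^ n), IsUnit w ∧
          (((({w * (u * r), w * (u * s), w * (u * t)} : Multiset (ZMod (2 ^ n))) = {-4, 1, 3} ∧
              ({w * r', w * s', w * t'} : Multiset (ZMod (2 ^ n))) = {(2 : ZMod (2 ^ n)) ^ (n - 1) - 2, (2 : ZMod (2 ^ n)) ^ (n - 1) - 1, 3}) ∨
            (({w * (u * r), w * (u * s), w * (u * t)} : Multiset (ZMod (2 ^ n))) = {(2 : ZMod (2 ^ n)) ^ (n - 1) - 2, (2 : ZMod (2 ^ n)) ^ (n - 1) - 1, 3} ∧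
              ({w * r', w * s', w * t'} : Multiset (ZMod (2 ^ n))) = {-4, 1, 3})) ∨
          ((({w * (u * r), w * (u * s), w * (u * t)} : Multiset (ZMod (2 ^ n))) = {-2, 1, 1} ∧
              ({w * r', w * s', w * t'} : Multiset (ZMod (2 ^ n))) = {(2 : ZMod (2 ^ n)) ^ (n - 1), 1, (2 : ZMod (2 ^ n)) ^ (n - 1) - 1}) ∨
            (({w * (u * r), w * (u * s), w * (u * t)} : Multiset (ZMod (2 ^ n))) = {(2 : ZMod (2 ^ n)) ^ (n - 1), 1, (2 : ZMod (2 ^ n)) ^ (n - 1) - 1} ∧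
              ({w * r', w * s', w * t'} : Multiset (ZMod (2 ^ n))) = {-2, 1, 1})) ∨
          ((({w * (u * r), w * (u * s), w * (u * t)} : Multiset (ZMod (2 ^ n))) = {-2, 1, 1} ∧
              ({w * r', w * s', w * t'} : Multiset (ZMod (2 ^ n))) = {2, (2 : ZMod (2 ^ n)) ^ (n - 1) - 1, (2 : ZMod (2 ^ n)) ^ (n - 1) - 1}) ∨
            (({w * (u * r), w * (u * s), w * (u * t)} : Multiset (ZMod (2 ^ n))) = {2, (2 : ZMod (2 ^ n)) ^ (n - 1) - 1, (2 : ZMod (2 ^ n)) ^ (n - 1) - 1} ∧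
              ({w * r', w * s', w * t'} : Multiset (ZMod (2 ^ n))) = {-2, 1, 1})) ∨
          ((({w * (u * r), w * (u * s), w * (u * t)} : Multiset (ZMod (2 ^ n))) = {(2 : ZMod (2 ^ n)) ^ (n - 1) - 2, 1, (2 : ZMod (2 ^ n)) ^ (n - 1) + 1} ∧
              ({w * r', w * s', w * t'} : Multiset (ZMod (2 ^ n))) = {-4, 2, 2}) ∨
            (({w * (u * r), w * (u * s), w * (u * t)} : Multiset (ZMod (2 ^ n))) = {-4, 2, 2} ∧
              ({w * r', w * s', w * t'} : Multiset (ZMod (2 ^ n))) = {(2 : ZMod (2 ^ n)) ^ (n - 1) - 2, 1, (2 : ZMod (2 ^ n)) ^ (n - 1) + 1})) ∨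
          ((({w * (u * r), w * (u * s), w * (u * t)} : Multiset (ZMod (2 ^ n))) = {(2 : ZMod (2 ^ n)) ^ (n - 1) - 2, 1, (2 : ZMod (2 ^ n)) ^ (n - 1) + 1} ∧
              ({w * r', w * s', w * t'} : Multiset (ZMod (2 ^ n))) = {2, (2 : ZMod (2 ^ n)) ^ (n - 2) - 1, 3 * (2 : ZMod (2 ^ n)) ^ (n - 2) - 1}) ∨
            (({w * (u * r), w * (u * s), w * (u * t)} : Multiset (ZMod (2 ^ n))) = {2, (2 : ZMod (2 ^ n)) ^ (n - 2) - 1, 3 * (2 : ZMod (2 ^ n)) ^ (n - 2) - 1} ∧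
              ({w * r', w * s', w * t'} : Multiset (ZMod (2 ^ n))) = {(2 : ZMod (2 ^ n)) ^ (n - 1) - 2, 1, (2 : ZMod (2 ^ n)) ^ (n - 1) + 1})) ∨
          ((({w * (u * r), w * (u * s), w * (u * t)} : Multiset (ZMod (2 ^ n))) = {(2 : ZMod (2 ^ n)) ^ (n - 1) - 2, 1, (2 : ZMod (2 ^ n)) ^ (n - 1) + 1} ∧
              ({w * r', w * s', w * t'} : Multiset (ZMod (2 ^ n))) = {(2 : ZMod (2 ^ n)) ^ (n - 1), 2, (2 : ZMod (2 ^ n)) ^ (n - 1) - 2}) ∨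
            (({w * (u * r), w * (u * s), w * (u * t)} : Multiset (ZMod (2 ^ n))) = {(2 : ZMod (2 ^ n)) ^ (n - 1), 2, (2 : ZMod (2 ^ n)) ^ (n - 1) - 2} ∧
              ({w * r', w * s', w * t'} : Multiset (ZMod (2 ^ n))) = {(2 : ZMod (2 ^ n)) ^ (n - 1) - 2, 1, (2 : ZMod (2 ^ n)) ^ (n - 1) + 1})) ∨
          ((({w * (u * r), w * (u * s), w * (u * t)} : Multiset (ZMod (2 ^ n))) = {2, (2 : ZMod (2 ^ n)) ^ (n - 2) - 1, 3 * (2 : ZMod (2 ^ n)) ^ (n - 2) - 1} ∧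
              ({w * r', w * s', w * t'} : Multiset (ZMod (2 ^ n))) = {-4, 2, 2}) ∨
            (({w * (u * r), w * (u * s), w * (u * t)} : Multiset (ZMod (2 ^ n))) = {-4, 2, 2} ∧
              ({w * r', w * s', w * t'} : Multiset (ZMod (2 ^ n))) = {2, (2 : ZMod (2 ^ n)) ^ (n - 2) - 1, 3 * (2 : ZMod (2 ^ n)) ^ (n - 2) - 1})))) := by
  rw [isIsogenous_fermatCMType_iff_exists_eq_mul hS hS' hA hA']
  refine exists_congr fun u => and_congr_right fun hu => ?_
  rw [← forall_mem_iff_eq_mul hu]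
  exact forall_mem_fermatCMType_iff_iff_perm_or_exceptional_twoPow hn hr0 hs0 ht0 hrst hr'0 hs'0 ht'0 hrst' hunit hu

/-- **THEOREM 4 ON ABELIAN VARIETIES, symmetric form**: under the same hypotheses, `A ∼ A′` iff EITHER `{r′,s′,t′} = {ur, us, ut}` for a
unit `u` ("obvious") OR for units `w, w′` the pair `({wr,ws,wt}, {w′r′,w′s′,w′t′})` is one of the seven pairs in either order — at level
`2ⁿ` the non-obvious isogenies among primitive triples amalgamate the classes of (1) `(N−4,1,3) ~ (N₁−2,N₁−1,3)`, (2) `(N−2,1,1) ~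
(N₁,1,N₁−1) ~ (2,N₁−1,N₁−1)`, (3) `(N₁−2,1,N₁+1) ~ (N−4,2,2) ~ (2,N₂−1,3N₂−1) ~ (N₁,2,N₁−2)` and nothing else.
[cite: KoblitzRohrlich1978, Theorem 4 (p. 1186) and §5 Proposition (p. 1200)] [cite: Shimura1998, §8.4 Example (1) and §6.1 Corollary] -/
theorem isIsogenous_iff_obvious_or_exceptional_twoPow [IsCMField L] (hn : 4 ≤ n) {r s t r' s' t' : ZMod (2 ^ n)}
    (hr0 : r ≠ 0) (hs0 : s ≠ 0) (ht0 : t ≠ 0) (hrst : r + s + t = 0)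
    (hr'0 : r' ≠ 0) (hs'0 : s' ≠ 0) (ht'0 : t' ≠ 0) (hrst' : r' + s' + t' = 0)
    (hunit : IsUnit r ∨ IsUnit s ∨ IsUnit t ∨ IsUnit r' ∨ IsUnit s' ∨ IsUnit t')
    (hS : IsCMResidueSet (2 ^ n) (fermatCMType (2 ^ n) r s t))
    (hS' : IsCMResidueSet (2 ^ n) (fermatCMType (2 ^ n) r' s' t'))
    (hA : IsCMTypeRealisation (cmTypeOfResidues (L := L) (fermatCMType (2 ^ n) r s t) hS.cm) A ι θ)
    (hA' : IsCMTypeRealisation (cmTypeOfResidues (L := L) (fermatCMType (2 ^ n) r' s' t') hS'.cm) A' ι' θ') :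
    AbelianVariety.IsIsogenous A A' ↔
      (∃ u : ZMod (2 ^ n), IsUnit u ∧ ({r', s', t'} : Multiset (ZMod (2 ^ n))) = {u * r, u * s, u * t}) ∨
        ∃ w w' : ZMod (2 ^ n), IsUnit w ∧ IsUnit w' ∧
          (((({w * r, w * s, w * t} : Multiset (ZMod (2 ^ n))) = {-4, 1, 3} ∧
              ({w' * r', w' * s', w' * t'} : Multiset (ZMod (2 ^ n))) = {(2 : ZMod (2 ^ n)) ^ (n - 1) - 2, (2 : ZMod (2 ^ n)) ^ (n - 1) - 1, 3}) ∨
            (({w * r, w * s, w * t} : Multiset (ZMod (2 ^ n))) = {(2 : ZMod (2 ^ n)) ^ (n - 1) - 2, (2 : ZMod (2 ^ n)) ^ (n - 1) - 1, 3} ∧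
              ({w' * r', w' * s', w' * t'} : Multiset (ZMod (2 ^ n))) = {-4, 1, 3})) ∨
          ((({w * r, w * s, w * t} : Multiset (ZMod (2 ^ n))) = {-2, 1, 1} ∧
              ({w' * r', w' * s', w' * t'} : Multiset (ZMod (2 ^ n))) = {(2 : ZMod (2 ^ n)) ^ (n - 1), 1, (2 : ZMod (2 ^ n)) ^ (n - 1) - 1}) ∨
            (({w * r, w * s, w * t} : Multiset (ZMod (2 ^ n))) = {(2 : ZMod (2 ^ n)) ^ (n - 1), 1, (2 : ZMod (2 ^ n)) ^ (n - 1) - 1} ∧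
              ({w' * r', w' * s', w' * t'} : Multiset (ZMod (2 ^ n))) = {-2, 1, 1})) ∨
          ((({w * r, w * s, w * t} : Multiset (ZMod (2 ^ n))) = {-2, 1, 1} ∧
              ({w' * r', w' * s', w' * t'} : Multiset (ZMod (2 ^ n))) = {2, (2 : ZMod (2 ^ n)) ^ (n - 1) - 1, (2 : ZMod (2 ^ n)) ^ (n - 1) - 1}) ∨
            (({w * r, w * s, w * t} : Multiset (ZMod (2 ^ n))) = {2, (2 : ZMod (2 ^ n)) ^ (n - 1) - 1, (2 : ZMod (2 ^ n)) ^ (n - 1) - 1} ∧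
              ({w' * r', w' * s', w' * t'} : Multiset (ZMod (2 ^ n))) = {-2, 1, 1})) ∨
          ((({w * r, w * s, w * t} : Multiset (ZMod (2 ^ n))) = {(2 : ZMod (2 ^ n)) ^ (n - 1) - 2, 1, (2 : ZMod (2 ^ n)) ^ (n - 1) + 1} ∧
              ({w' * r', w' * s', w' * t'} : Multiset (ZMod (2 ^ n))) = {-4, 2, 2}) ∨
            (({w * r, w * s, w * t} : Multiset (ZMod (2 ^ n))) = {-4, 2, 2} ∧
              ({w' * r', w' * s', w' * t'} : Multiset (ZMod (2 ^ n))) = {(2 : ZMod (2 ^ n)) ^ (n - 1) - 2, 1, (2 : ZMod (2 ^ n)) ^ (n - 1) + 1})) ∨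
          ((({w * r, w * s, w * t} : Multiset (ZMod (2 ^ n))) = {(2 : ZMod (2 ^ n)) ^ (n - 1) - 2, 1, (2 : ZMod (2 ^ n)) ^ (n - 1) + 1} ∧
              ({w' * r', w' * s', w' * t'} : Multiset (ZMod (2 ^ n))) = {2, (2 : ZMod (2 ^ n)) ^ (n - 2) - 1, 3 * (2 : ZMod (2 ^ n)) ^ (n - 2) - 1}) ∨
            (({w * r, w * s, w * t} : Multiset (ZMod (2 ^ n))) = {2, (2 : ZMod (2 ^ n)) ^ (n - 2) - 1, 3 * (2 : ZMod (2 ^ n)) ^ (n - 2) - 1} ∧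
              ({w' * r', w' * s', w' * t'} : Multiset (ZMod (2 ^ n))) = {(2 : ZMod (2 ^ n)) ^ (n - 1) - 2, 1, (2 : ZMod (2 ^ n)) ^ (n - 1) + 1})) ∨
          ((({w * r, w * s, w * t} : Multiset (ZMod (2 ^ n))) = {(2 : ZMod (2 ^ n)) ^ (n - 1) - 2, 1, (2 : ZMod (2 ^ n)) ^ (n - 1) + 1} ∧
              ({w' * r', w' * s', w' * t'} : Multiset (ZMod (2 ^ n))) = {(2 : ZMod (2 ^ n)) ^ (n - 1), 2, (2 : ZMod (2 ^ n)) ^ (n - 1) - 2}) ∨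
            (({w * r, w * s, w * t} : Multiset (ZMod (2 ^ n))) = {(2 : ZMod (2 ^ n)) ^ (n - 1), 2, (2 : ZMod (2 ^ n)) ^ (n - 1) - 2} ∧
              ({w' * r', w' * s', w' * t'} : Multiset (ZMod (2 ^ n))) = {(2 : ZMod (2 ^ n)) ^ (n - 1) - 2, 1, (2 : ZMod (2 ^ n)) ^ (n - 1) + 1})) ∨
          ((({w * r, w * s, w * t} : Multiset (ZMod (2 ^ n))) = {2, (2 : ZMod (2 ^ n)) ^ (n - 2) - 1, 3 * (2 : ZMod (2 ^ n)) ^ (n - 2) - 1} ∧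
              ({w' * r', w' * s', w' * t'} : Multiset (ZMod (2 ^ n))) = {-4, 2, 2}) ∨
            (({w * r, w * s, w * t} : Multiset (ZMod (2 ^ n))) = {-4, 2, 2} ∧
              ({w' * r', w' * s', w' * t'} : Multiset (ZMod (2 ^ n))) = {2, (2 : ZMod (2 ^ n)) ^ (n - 2) - 1, 3 * (2 : ZMod (2 ^ n)) ^ (n - 2) - 1}))) := by
  rw [isIsogenous_fermatCMType_iff_twoPow hn hr0 hs0 ht0 hrst hr'0 hs'0 ht'0 hrst' hunit hS hS' hA hA']
  constructor
  · rintro ⟨u, hu, hperm | ⟨w, hw, h⟩⟩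
    · exact Or.inl ⟨u, hu, hperm⟩
    · refine Or.inr ⟨w * u, w, hw.mul hu, hw, ?_⟩
      simpa only [mul_assoc] using h
  · rintro (⟨u, hu, hperm⟩ | ⟨w, w', hw, hw', h⟩)
    · exact ⟨u, hu, Or.inl hperm⟩
    · obtain ⟨wi, hwi⟩ := hw'.exists_right_inv
      have hwi' : IsUnit wi := IsUnit.of_mul_eq_one_right w' hwi
      refine ⟨wi * w, hwi'.mul hw, Or.inr ⟨w', hw', ?_⟩⟩
      have e : ∀ z : ZMod (2 ^ n), w' * (wi * w * z) = w * z := fun z => by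
        rw [← mul_assoc, ← mul_assoc, hwi, one_mul]
      rw [e, e, e]
      exact h

/-- **NON-VACUITY — THE NON-OBVIOUS ISOGENY (1) EXISTS at every `N = 2ⁿ`, `n ≥ 4`**: there are abelian varieties `B`, `B′` with complex
multiplication by `ℚ(ζ_{2ⁿ})` of the types `Φ_{H_{(N−4, 1, 3)}}` and `Φ_{H_{(N₁−2, N₁−1, 3)}}` (realisations exist: Shimura §6.2 Thm. 3),
both of dimension `φ(2ⁿ)/2 = 2ⁿ⁻²`; they are ISOGENOUS (`H` equal, pair (1)), and `(N₁−2, N₁−1, 3)` is NOT a unit multiple of a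
permutation of `(N−4, 1, 3)` (sibling `not_exists_multiset_eq_twoPow_d`: Theorem 4 d)₀ is not "obvious").
[cite: KoblitzRohrlich1978, Theorem 4 d) (p. 1186), §5 Proposition (1) (p. 1200), §1 (p. 1184)] [cite: Shimura1998, §6.2 Thm. 3, §8.4 Example (1)] -/
theorem exists_isIsogenous_not_obvious_twoPow (hn : 4 ≤ n) :
    ∃ (hS : IsCMResidueSet (2 ^ n) (fermatCMType (2 ^ n) (-4) 1 3))
      (hS' : IsCMResidueSet (2 ^ n) (fermatCMType (2 ^ n) ((2 : ZMod (2 ^ n)) ^ (n - 1) - 2) ((2 : ZMod (2 ^ n)) ^ (n - 1) - 1) 3))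
      (B : AbelianVariety ℂ) (ι₁ : 𝓞 L →+* End B) (θ₁ : L →+* Module.End ℂ (complexBetti B.X 1))
      (B' : AbelianVariety ℂ) (ι₂ : 𝓞 L →+* End B') (θ₂ : L →+* Module.End ℂ (complexBetti B'.X 1)),
      IsCMTypeRealisation (cmTypeOfResidues (L := L) (fermatCMType (2 ^ n) (-4) 1 3) hS.cm) B ι₁ θ₁ ∧
        IsCMTypeRealisation (cmTypeOfResidues (L := L) (fermatCMType (2 ^ n) ((2 : ZMod (2 ^ n)) ^ (n - 1) - 2) ((2 : ZMod (2 ^ n)) ^ (n - 1) - 1) 3) hS'.cm) B' ι₂ θ₂ ∧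
        B.dim = (2 ^ n).totient / 2 ∧ B'.dim = (2 ^ n).totient / 2 ∧ AbelianVariety.IsIsogenous B B' ∧
        ¬∃ u : ZMod (2 ^ n),
          ({(2 : ZMod (2 ^ n)) ^ (n - 1) - 2, (2 : ZMod (2 ^ n)) ^ (n - 1) - 1, 3} : Multiset (ZMod (2 ^ n))) = {u * -4, u * 1, u * 3} := by
  have hn0 : n ≠ 0 := by omega
  have hn3 : 3 ≤ n := by omega
  haveI : Fact (1 < 2 ^ n) := ⟨Nat.one_lt_pow hn0 (by norm_num)⟩
  have h16 : 16 ≤ 2 ^ n := by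
    calc (16 : ℕ) = 2 ^ 4 := by norm_num
      _ ≤ 2 ^ n := Nat.pow_le_pow_right (by norm_num) hn
  have h2N : 2 < 2 ^ n := by omega
  -- the first triple is admissible
  have h4 : (-4 : ZMod (2 ^ n)) ≠ 0 := by
    have h := two_pow_ne_zero_of_lt (n := n) (j := 2) (by omega)
    intro h0
    exact h (by linear_combination -h0)
  have h3 : IsUnit (3 : ZMod (2 ^ n)) := (isUnit_iff_castHom_two_eq_one hn0 _).2 (by rw [map_ofNat]; decide)
  have hsum : (-4 : ZMod (2 ^ n)) + 1 + 3 = 0 := by ring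
  have hS : IsCMResidueSet (2 ^ n) (fermatCMType (2 ^ n) (-4) 1 3) := isCMResidueSet_fermatCMType_of_ne_zero h4 one_ne_zero h3.ne_zero hsum
  have hS' : IsCMResidueSet (2 ^ n) (fermatCMType (2 ^ n) ((2 : ZMod (2 ^ n)) ^ (n - 1) - 2) ((2 : ZMod (2 ^ n)) ^ (n - 1) - 1) 3) := by
    rw [pair₁ hn3]
    exact hS
  haveI : IsCMField L := IsCyclotomicExtension.Rat.isCMField L (S := {2 ^ n}) ⟨2 ^ n, rfl, h2N⟩
  obtain ⟨B, ι₁, θ₁, hB⟩ := exists_isCMTypeRealisation (cmTypeOfResidues (L := L) (fermatCMType (2 ^ n) (-4) 1 3) hS.cm)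
  obtain ⟨B', ι₂, θ₂, hB'⟩ := exists_isCMTypeRealisation (cmTypeOfResidues (L := L) (fermatCMType (2 ^ n) ((2 : ZMod (2 ^ n)) ^ (n - 1) - 2) ((2 : ZMod (2 ^ n)) ^ (n - 1) - 1) 3) hS'.cm)
  refine ⟨hS, hS', B, ι₁, θ₁, B', ι₂, θ₂, hB, hB', dim_eq_of_realisation (N := 2 ^ n) hB,
    dim_eq_of_realisation (N := 2 ^ n) hB', ?_, ?_⟩
  · rw [isIsogenous_fermatCMType_iff_exists_eq_mul hS hS' hB hB']
    refine ⟨1, isUnit_one, ?_⟩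
    rw [one_mul, one_mul, one_mul]
    exact pair₁ hn3
  · -- the sibling's `not_exists_multiset_eq_twoPow_d`, entries respelled as residues
    have hle : 2 ≤ 2 ^ (n - 1) := by
      calc (2 : ℕ) = 2 ^ 1 := (pow_one 2).symm
        _ ≤ 2 ^ (n - 1) := Nat.pow_le_pow_right (by norm_num) (by omega)
    have e1 : ((2 ^ (n - 1) - 1 : ℕ) : ZMod (2 ^ n)) = (2 : ZMod (2 ^ n)) ^ (n - 1) - 1 := by
      rw [Nat.cast_sub (by omega), Nat.cast_pow, Nat.cast_ofNat, Nat.cast_one]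
    have e2 : ((2 ^ (n - 1) - 2 : ℕ) : ZMod (2 ^ n)) = (2 : ZMod (2 ^ n)) ^ (n - 1) - 2 := by
      rw [Nat.cast_sub hle, Nat.cast_pow, Nat.cast_ofNat]
    have e4 : ((2 ^ n - 4 : ℕ) : ZMod (2 ^ n)) = -4 := by
      rw [Nat.cast_sub (by omega), ZMod.natCast_self, zero_sub, Nat.cast_ofNat]
    have h := not_exists_multiset_eq_twoPow_d hn
    rw [e1, e2, e4] at h
    rintro ⟨u, hu⟩
    exact h ⟨u, (triple_swap_left' _ _ _).trans (hu.trans (triple_rotate' _ _ _).symm)⟩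

end AbelianVarieties

end CyclotomicFermatCMType

end Literature.AlgebraicGeometry.ComplexMultiplication
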